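import Literature.AlgebraicGeometry.HodgeTheory.UnitaryReflectionGroupZariskiDense
import HarnessLib

/-!
# Zariski closures: from the REAL points of a subgroup of `GL_ℂ(W)` back to its complex points
# (restriction of scalars `ℂ → ℝ`; Borel, *Linear Algebraic Groups*, AG §§11–12, "Weil restriction")

Family `hodge`, layer `Literature/AlgebraicGeometry/HodgeTheory`. THEOREMS only. Companion of
`ZariskiClosureBaseChange` (descent along an EXTENSION `K ⊆ L`: `L ⊗_K V`); here the other direction of
travel that the consumers need — RESTRICTION of scalars from `ℂ` to `ℝ`, the setting of littype's
`UnitaryReflectionGroupZariskiDense`, whose named fact `carlsonToledo1999_unitaryReflection_zariskiDense`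
("`PΓ` Zariski-dense in `PU(p,q)`", a REAL algebraic group) concludes on the real points
`restrictScalarsRealHom W : GL_ℂ(W) →* GL_ℝ(W)`. Every complex argument downstream (the identity-component
statement D of crux K1 `VeryGeneralDeckCommutatorsInHg`, route `CyclicUnitaryPowers`, skeleton v7 lanes A/D)
needs: if the real points of `g ∈ GL_ℂ(W)` lie in the REAL Zariski closure of the real points of `Γ`, then
`g` lies in the COMPLEX Zariski closure of `Γ` — because a complex polynomial in the complex matrix entries is
`Q₁ + i Q₂` with `Q₁, Q₂` real polynomials in the real matrix entries (Weil restriction: the complex entries are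
`ℝ`-linear in the real entries, Borel AG 12.4). Written by the prover seat `hodge-nonav-prover-Ax`.

## What is proved
* `exists_map_ofReal_add_I_mul` — every `Q ∈ ℂ[x_σ]` is `Q₁ + i·Q₂` with `Q₁, Q₂ ∈ ℝ[x_σ]` (coefficientwise
  real and imaginary parts, by induction on `Q`); `eval_ofReal_map_ofReal` — evaluating `Q₁ ⊗ ℂ` at a real
  point is the real evaluation.
* **`mem_glZariskiClosure_of_restrictScalarsRealHom`** — for `Γ ≤ GL_ℂ(W)` and `g ∈ GL_ℂ(W)`:
  `restrictScalarsRealHom W g ∈ glZariskiClosure (Γ.map (restrictScalarsRealHom W))` (real closure of real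
  points) implies `g ∈ glZariskiClosure Γ` (complex closure).

## References
* [Borel1991] A. Borel, *Linear Algebraic Groups*, 2nd ed., AG §11.4, §12.4 (restriction of the ground
  field; `k`-structures and polynomial functions).
* [CarlsonToledo1999] J. A. Carlson, D. Toledo, Duke Math. J. 97 (1999), §7 (the real group `PU(p,q)` in which
  density is asserted).
-/

noncomputable section

open Module Literature.AlgebraicGeometry.Motives

namespace Literature.AlgebraicGeometry.HodgeTheory

/-! ### §1 Real and imaginary parts of a complex polynomial -/

section ReIm

variable {σ : Type*}

/-- Evaluating the complexification `Q ⊗ ℂ` of a real polynomial at a real point is the real evaluation.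
[cite: Borel1991, AG §12.4] -/
theorem eval_ofReal_map_ofReal (x : σ → ℝ) (Q : MvPolynomial σ ℝ) :
    MvPolynomial.eval (fun i => (x i : ℂ)) (MvPolynomial.map Complex.ofRealHom Q) =
      (MvPolynomial.eval x Q : ℂ) := by
  rw [MvPolynomial.eval_map]
  change MvPolynomial.eval₂ Complex.ofRealHom (Complex.ofRealHom ∘ x) Q =
    Complex.ofRealHom (MvPolynomial.eval₂ (RingHom.id ℝ) x Q)
  rw [MvPolynomial.eval₂_comp_left Complex.ofRealHom (RingHom.id ℝ) x Q, RingHom.comp_id]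

/-- **Every complex polynomial is `Q₁ + i Q₂` with `Q₁, Q₂` real polynomials** (coefficientwise real and
imaginary parts). [cite: Borel1991, AG §12.4] -/
theorem exists_map_ofReal_add_I_mul (Q : MvPolynomial σ ℂ) :
    ∃ Q₁ Q₂ : MvPolynomial σ ℝ, Q = MvPolynomial.map Complex.ofRealHom Q₁ +
      MvPolynomial.C Complex.I * MvPolynomial.map Complex.ofRealHom Q₂ := by
  induction Q using MvPolynomial.induction_on with
  | C a =>
    refine ⟨MvPolynomial.C a.re, MvPolynomial.C a.im, ?_⟩
    rw [MvPolynomial.map_C, MvPolynomial.map_C, ← MvPolynomial.C_mul, ← MvPolynomial.C_add]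
    congr 1
    rw [Complex.ofRealHom_eq_coe, Complex.ofRealHom_eq_coe, mul_comm]
    exact (Complex.re_add_im a).symm
  | add p q hp hq =>
    obtain ⟨p₁, p₂, rfl⟩ := hp
    obtain ⟨q₁, q₂, rfl⟩ := hq
    exact ⟨p₁ + q₁, p₂ + q₂, by rw [map_add, map_add]; ring⟩
  | mul_X p n hp =>
    obtain ⟨p₁, p₂, rfl⟩ := hp
    refine ⟨p₁ * MvPolynomial.X n, p₂ * MvPolynomial.X n, ?_⟩
    rw [map_mul, map_mul, MvPolynomial.map_X]
    ring

/-- At a real point, `(Q₁ + i Q₂)(x) = Q₁(x) + i Q₂(x)` with real `Q₁(x), Q₂(x)`; hence it vanishes iff both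
real evaluations vanish. [cite: Borel1991, AG §12.4] -/
theorem eval_ofReal_eq_zero_iff (x : σ → ℝ) (Q₁ Q₂ : MvPolynomial σ ℝ) :
    MvPolynomial.eval (fun i => (x i : ℂ)) (MvPolynomial.map Complex.ofRealHom Q₁ +
      MvPolynomial.C Complex.I * MvPolynomial.map Complex.ofRealHom Q₂) = 0 ↔
      MvPolynomial.eval x Q₁ = 0 ∧ MvPolynomial.eval x Q₂ = 0 := by
  rw [map_add, map_mul, MvPolynomial.eval_C, eval_ofReal_map_ofReal, eval_ofReal_map_ofReal]
  constructor
  · intro h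
    have hre := congrArg Complex.re h
    have him := congrArg Complex.im h
    simp only [Complex.add_re, Complex.ofReal_re, Complex.mul_re, Complex.I_re, zero_mul, Complex.I_im,
      Complex.ofReal_im, mul_zero, sub_zero, add_zero, Complex.zero_re, Complex.add_im, Complex.mul_im,
      one_mul, zero_add, Complex.zero_im] at hre him
    exact ⟨hre, him⟩
  · rintro ⟨h₁, h₂⟩
    rw [h₁, h₂, Complex.ofReal_zero, mul_zero, add_zero]

end ReIm

/-! ### §2 Complex matrix entries are `ℝ`-linear in the real matrix entries -/

section RealPoints

variable {W : Type} [AddCommGroup W] [Module ℂ W] [FiniteDimensional ℂ W]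

omit [FiniteDimensional ℂ W] in
/-- The underlying real-linear map of the real points of `g`. [cite: Borel1991, AG §11.4] -/
theorem coe_restrictScalarsRealHom (g : W ≃ₗ[ℂ] W) :
    ((restrictScalarsRealHom W g : W ≃ₗ[ℝ] W) : W →ₗ[ℝ] W) = (g : W →ₗ[ℂ] W).restrictScalars ℝ :=
  rfl

variable {ι κ : Type*} [Fintype ι] [DecidableEq ι] [Fintype κ] [DecidableEq κ]

/-- The `(k,l)` complex matrix entry (for a complex basis `b`) read off a REAL matrix (for a real basis
`br`): `M ↦ (b.repr (toLin br br M (b l)))_k`, an `ℝ`-linear map `M_κ(ℝ) → ℂ`. [cite: Borel1991, AG §12.4] -/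
def entryOfRealMatrix (b : Basis ι ℂ W) (br : Basis κ ℝ W) (k l : ι) : Matrix κ κ ℝ →ₗ[ℝ] ℂ :=
  ((b.coord k).restrictScalars ℝ) ∘ₗ (LinearMap.applyₗ (b l)) ∘ₗ (Matrix.toLin br br).toLinearMap

omit [FiniteDimensional ℂ W] in
/-- On the real matrix of a complex-linear `f`, `entryOfRealMatrix` returns the complex entry `f_{kl}`.
[cite: Borel1991, AG §12.4] -/
theorem entryOfRealMatrix_toMatrix (b : Basis ι ℂ W) (br : Basis κ ℝ W) (k l : ι) (f : W →ₗ[ℂ] W) :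
    entryOfRealMatrix b br k l (LinearMap.toMatrix br br (f.restrictScalars ℝ)) = LinearMap.toMatrix b b f k l := by
  simp only [entryOfRealMatrix, LinearMap.coe_comp, Function.comp_apply, LinearEquiv.coe_toLinearMap,
    Matrix.toLin_toMatrix, LinearMap.applyₗ_apply_apply, LinearMap.coe_restrictScalars,
    LinearMap.toMatrix_apply, Basis.coord_apply]

omit [FiniteDimensional ℂ W] [Fintype ι] [DecidableEq ι] in
/-- Expansion of the `ℝ`-linear functional along the real entries: `φ(M) = Σ_{ac} M_{ac} · φ(E_{ac})`.
[cite: Borel1991, AG §12.4] -/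
theorem entryOfRealMatrix_eq_sum (b : Basis ι ℂ W) (br : Basis κ ℝ W) (k l : ι) (M : Matrix κ κ ℝ) :
    entryOfRealMatrix b br k l M =
      ∑ a : κ, ∑ c : κ, (M a c : ℂ) * entryOfRealMatrix b br k l (Matrix.single a c 1) := by
  conv_lhs => rw [Matrix.matrix_eq_sum_single M]
  rw [map_sum]
  refine Finset.sum_congr rfl fun a _ => ?_
  rw [map_sum]
  refine Finset.sum_congr rfl fun c _ => ?_
  rw [show Matrix.single a c (M a c) = M a c • Matrix.single a c (1 : ℝ) by
    rw [Matrix.smul_single, smul_eq_mul, mul_one], map_smul, Complex.real_smul]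

/-- **From the real Zariski closure of the real points to the complex Zariski closure** (restriction of
scalars `ℂ → ℝ`): if `restrictScalarsRealHom W g` lies in the real closure of the real points
`Γ.map (restrictScalarsRealHom W)` of `Γ ≤ GL_ℂ(W)`, then `g ∈ Γ^Zar(ℂ)`. Proof: a complex polynomial `P`
in the complex entries vanishing on `Γ`, composed with the `ℝ`-linear expressions of the complex entries in
the real entries (`entryOfRealMatrix_eq_sum`), is `Q₁ + i Q₂` with `Q₁, Q₂` real polynomials in the real
entries vanishing on the real points of `Γ`, hence at the real points of `g`.
[cite: Borel1991, AG §11.4 and §12.4] -/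
theorem mem_glZariskiClosure_of_restrictScalarsRealHom {Γ : Subgroup (W ≃ₗ[ℂ] W)} {g : W ≃ₗ[ℂ] W}
    (h : restrictScalarsRealHom W g ∈ glZariskiClosure (Γ.map (restrictScalarsRealHom W))) :
    g ∈ glZariskiClosure Γ := by
  classical
  let b := Module.Free.chooseBasis ℂ W
  let br := Module.Free.chooseBasis ℝ W
  rw [mem_glZariskiClosure_iff, ← zariskiClosureEnd_basis_indep b, mem_zariskiClosureEndOfBasis_iff]
  rw [mem_glZariskiClosure_iff, ← zariskiClosureEnd_basis_indep br, mem_zariskiClosureEndOfBasis_iff] at h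
  intro P hP
  -- the ℝ-linear substitution: complex entry `(k,l)` ↦ `Σ_{ac} w_{kl,ac} X_{ac}`
  let S : Module.Free.ChooseBasisIndex ℂ W × Module.Free.ChooseBasisIndex ℂ W →
      MvPolynomial (Module.Free.ChooseBasisIndex ℝ W × Module.Free.ChooseBasisIndex ℝ W) ℂ :=
    fun kl => ∑ a, ∑ c, MvPolynomial.C (entryOfRealMatrix b br kl.1 kl.2 (Matrix.single a c 1)) *
      MvPolynomial.X (a, c)
  let Q := MvPolynomial.bind₁ S P
  -- evaluation of `Q` at the real points of a complex-linear `f` is evaluation of `P` at `f`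
  have hQ : ∀ f : W ≃ₗ[ℂ] W,
      MvPolynomial.eval (fun ac => (LinearMap.toMatrix br br
        ((restrictScalarsRealHom W f : W ≃ₗ[ℝ] W) : W →ₗ[ℝ] W) ac.1 ac.2 : ℂ)) Q =
      MvPolynomial.eval (fun kl => LinearMap.toMatrix b b (f : W →ₗ[ℂ] W) kl.1 kl.2) P := by
    intro f
    rw [show Q = MvPolynomial.bind₁ S P from rfl, MvPolynomial.eval, MvPolynomial.eval₂Hom_bind₁,
      ← MvPolynomial.eval, ← MvPolynomial.eval]
    refine congrArg (fun c => MvPolynomial.eval c P) (funext fun kl => ?_)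
    simp only [S, map_sum, map_mul, MvPolynomial.eval_C, MvPolynomial.eval_X]
    rw [coe_restrictScalarsRealHom, ← entryOfRealMatrix_toMatrix b br kl.1 kl.2 (f : W →ₗ[ℂ] W),
      entryOfRealMatrix_eq_sum]
    refine Finset.sum_congr rfl fun a _ => Finset.sum_congr rfl fun c _ => ?_
    rw [mul_comm]
  -- `Q = Q₁ + i Q₂` with real `Q₁, Q₂`, which vanish on the real points of `Γ`
  obtain ⟨Q₁, Q₂, hQ12⟩ := exists_map_ofReal_add_I_mul Q
  have hvan : ∀ j : Fin 2, ∀ s ∈ (fun h : W ≃ₗ[ℝ] W => (h : Module.End ℝ W)) ''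
      (Γ.map (restrictScalarsRealHom W) : Set (W ≃ₗ[ℝ] W)),
      MvPolynomial.eval (fun ac => LinearMap.toMatrix br br s ac.1 ac.2) (if j = 0 then Q₁ else Q₂) = 0 := by
    rintro j _ ⟨x, hx, rfl⟩
    obtain ⟨γ, hγ, rfl⟩ := Subgroup.mem_map.1 hx
    have h0 := hQ γ
    rw [hP _ ⟨γ, hγ, rfl⟩, hQ12, eval_ofReal_eq_zero_iff] at h0
    fin_cases j
    · exact h0.1
    · exact h0.2
  have h₁ : MvPolynomial.eval (fun ac => LinearMap.toMatrix br br
      ((restrictScalarsRealHom W g : W ≃ₗ[ℝ] W) : W →ₗ[ℝ] W) ac.1 ac.2) Q₁ = 0 := h Q₁ (hvan 0)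
  have h₂ : MvPolynomial.eval (fun ac => LinearMap.toMatrix br br
      ((restrictScalarsRealHom W g : W ≃ₗ[ℝ] W) : W →ₗ[ℝ] W) ac.1 ac.2) Q₂ = 0 := h Q₂ (hvan 1)
  have hg := hQ g
  rw [hQ12, (eval_ofReal_eq_zero_iff _ Q₁ Q₂).2 ⟨h₁, h₂⟩] at hg
  exact hg.symm

end RealPoints

end Literature.AlgebraicGeometry.HodgeTheory

end
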